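import Summits.AtomisticToContinuum.HydrodynamicLimit.Theses.InformationPercolationEngine
import Literature.MathematicalPhysics.KineticTheory.EvenCollisionTubeFunctional
import Literature.MathematicalPhysics.KineticTheory.HardSphereCrossSection

/-!
# `CollisionRate` (route InformationPercolationEngine) is the constant-mark instance of the even collision statistic

Helper for the support item `InformationPercolationEngine.CollisionRate` (stmt-AtomisticToContinuum-13481): the Enskog
collision-frequency law `K_N[χ g(σ³ρ_r)] − σ³∫₀^τ∫ χ g Y(σ³ρ_r) B¹_r → 0` in probability for deterministic hard spheres at
fixed reduced density. Its `let`-chain is — up to the literal constant `Real.pi * ‖v − w‖` standing for the sphere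
integral `∫_{S²}((w − v)·ω)₊ dω` — VERBATIM the crux statistic `evenStat σ N Φ τ χ g Ξ r` of
`Literature.MathematicalPhysics.KineticTheory.EvenCollisionTubeFunctional` (the chassis of crux
`JParityClosure.EvenStressEnskog`, stmt-AtomisticToContinuum-13079) at the CONSTANT mark `Ξ ≡ 1`:

* `sphereMark_const_one` — `Θ 1 (v, w) = ∫_{S²} ((w − v)·ω)₊ dω = π‖v − w‖` (the cross-section constant
  `Literature.MathematicalPhysics.KineticTheory.integral_hardSphereKernel_eq_pi_mul_norm`);
* `stat_eq_evenStat_one` — the item's functional `D z` equals `evenStat σ N Φ τ χ g (fun _ => 1) r z`, pointwise in the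
  configuration `z` (definitional unfolding + the constant);
* `collisionRate_iff_evenStat_one` — hence `CollisionRate` is literally the statement
  `∃ η₀ > 0, ∀ profiles …, localGibbsLaw … {z | η < |evenStat σ N (Φ N) τ χ g (fun _ => 1) r z|} ≤ δ`, i.e. the
  `JParityClosure.EvenStressEnskog` frame with the nine marks `Ξ_P^{kl}` replaced by the single bounded continuous mark `1`.

Consequence for staffing (recorded on the item): any proof of the `even-rung-mean-variance` chassis
(`Cruxes/EvenStressEnskog/Lines/even-rung-mean-variance.lean`: truncate · tube pull-back · mean · fixed-time variance ·
Chebyshev · regularity) whose stubs are stated for a general bounded continuous mark closes this item through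
`collisionRate_iff_evenStat_one`; conversely the open cores are the same (mean = Enskog closure in expectation for `t > 0`;
fixed-time variance). No dynamics is proved here. prover-pitem-stmt-AtomisticToContinuum-13481-2.
-/

noncomputable section

namespace Summit.AtomisticToContinuum.HydrodynamicLimit.Theorems.CollisionRate

open MeasureTheory Set
open scoped InnerProductSpace
open Literature.MathematicalPhysics.KineticTheory Literature.Analysis.FluidPDE

/-- **The constant mark integrates to the cross-section**: `sphereMark 1 v w = ∫_{S²} ((w − v)·ω)₊ dω = π ‖v − w‖`
(`integral_hardSphereKernel_eq_pi_mul_norm`, i.e. `|B²| = π`). [folklore] -/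
theorem sphereMark_const_one (v w : V3) : sphereMark (fun _ => (1 : ℝ)) v w = Real.pi * ‖v - w‖ := by
  unfold sphereMark
  simp only [one_mul]
  rw [integral_hardSphereKernel_eq_pi_mul_norm, norm_sub_rev]

/-- **The item's statistic is `evenStat` at the constant mark.** For every reduced diameter `σ`, particle number
`N + 1`, flow `Φ`, horizon `τ`, localiser `χ`, cutoff `g`, mollification radius `r` and configuration `z`, the
`let`-chain of `InformationPercolationEngine.CollisionRate` (collision sum of `χ g(σ³ρ_r)` minus `σ³ ∫₀^τ∫ χ g Y B¹_r`)
equals `evenStat σ N Φ τ χ g (fun _ => 1) r z` (unfolding; the only non-definitional step is `sphereMark_const_one`).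
[folklore] -/
theorem stat_eq_evenStat_one (σ : ℝ) (N : ℕ)
    (Φ : HardSphereFlow (Torus.geometry (Fin 3)) (hsDiameter σ N) (N + 1))
    (τ : ℝ) (χ : ℝ × T3 → ℝ) (g : ℝ → ℝ) (r : ℝ) (z : Config (N + 1) (Fin 3) T3) :
    (let ε := hsDiameter σ N
     let G : Geometry (Fin 3) T3 := Torus.geometry (Fin 3)
     let γ : Config (N + 1) (Fin 3) T3 → ℝ → Config (N + 1) (Fin 3) T3 := fun z s => Φ.flow s z
     let bx : T3 → T3 → ℝ := fun x y => 3 / (Real.pi * r ^ 3) * max (1 - Torus.euclidDist x y / r) 0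
     let ρm : Config (N + 1) (Fin 3) T3 → ℝ → T3 → ℝ :=
       fun z s x₀ => ∫ q, bx q.1 x₀ ∂(empiricalMeasure (γ z s))
     let B1 : Config (N + 1) (Fin 3) T3 → ℝ → T3 → ℝ := fun z s x₀ =>
       ∫ p, bx p.1.1 x₀ * bx p.2.1 x₀ * (Real.pi * ‖p.1.2 - p.2.2‖)
         ∂((empiricalMeasure (γ z s)).prod (empiricalMeasure (γ z s)))
     let Kc : (Config (N + 1) (Fin 3) T3 → ℝ → Fin (N + 1) → Fin (N + 1) → ℝ) →
         Config (N + 1) (Fin 3) T3 → ℝ :=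
       fun F z => ε / (N + 1 : ℝ) * ∑ᶠ (s : ℝ) (_ : s ∈ collisionTimes G ε (γ z) ∩ Set.Icc 0 τ),
         ∑ i : Fin (N + 1), ∑ j : Fin (N + 1),
           (if i ≠ j ∧ ‖G.sepVec (γ z s i).1 (γ z s j).1‖ = ε then F z s i j else 0)
     let Y : ℝ → ℝ := fun a => 3 / (2 * Real.pi) * deriv hsExcessFreeEnergy a
     Kc (fun z s i _ => χ (s, (γ z s i).1) * g (σ ^ 3 * ρm z s (γ z s i).1)) z -
       σ ^ 3 * ∫ s in Set.Icc (0 : ℝ) τ, ∫ x : T3,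
         χ (s, x) * g (σ ^ 3 * ρm z s x) * Y (σ ^ 3 * ρm z s x) * B1 z s x)
    = evenStat σ N Φ τ χ g (fun _ => 1) r z := by
  dsimp only [evenStat, Literature.MathematicalPhysics.KineticTheory.collisionSum, enskogRate, pairFunctional,
    mollDensity, coneKernel, contactValue]
  simp only [mul_one, sphereMark_const_one]

/-- **`CollisionRate` ↔ the `EvenStressEnskog` frame at the constant mark.** The support item
`InformationPercolationEngine.CollisionRate` (stmt-AtomisticToContinuum-13481) is, word for word, the statement that for
a universal `η₀ > 0`, all continuous positive profiles, `σ < σ₀`, all flow families, horizons, localisers, cutoffs `g`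
vanishing on `[η₀, ∞)` and all `η, δ > 0`, eventually in `r → 0` then `N → ∞`,
`P(η < |evenStat σ N (Φ N) τ χ g 1 r|) ≤ δ` — the crux `JParityClosure.EvenStressEnskog` with its marks `Ξ_P^{kl}`
replaced by the constant mark `1` (no `∀ k l`). [folklore] -/
theorem collisionRate_iff_evenStat_one :
    Summit.AtomisticToContinuum.HydrodynamicLimit.Theses.InformationPercolationEngine.CollisionRate ↔
    ∃ η₀ : ℝ, 0 < η₀ ∧ ∀ (a₀ θ₀ : T3 → ℝ) (u₀ : T3 → V3), Continuous a₀ → Continuous θ₀ → Continuous u₀ →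
      (∀ x, 0 < a₀ x) → (∀ x, 0 < θ₀ x) → ∃ σ₀ : ℝ, 0 < σ₀ ∧ ∀ σ : ℝ, 0 < σ → σ < σ₀ →
      ∀ Φ : (N : ℕ) → HardSphereFlow (Torus.geometry (Fin 3)) (hsDiameter σ N) (N + 1),
      ∀ τ : ℝ, 0 < τ → ∀ χ : ℝ × T3 → ℝ, Continuous χ → ∀ g : ℝ → ℝ, Continuous g →
      (∀ a, η₀ ≤ a → g a = 0) →
      ∀ η δ : ℝ, 0 < η → 0 < δ → ∃ r₀ : ℝ, 0 < r₀ ∧ ∀ r : ℝ, 0 < r → r < r₀ →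
      ∃ N₀ : ℕ, ∀ N : ℕ, N₀ ≤ N →
        localGibbsLaw σ a₀ u₀ θ₀ N (Φ N) {z | η < |evenStat σ N (Φ N) τ χ g (fun _ => 1) r z|}
          ≤ ENNReal.ofReal δ := by
  unfold Summit.AtomisticToContinuum.HydrodynamicLimit.Theses.InformationPercolationEngine.CollisionRate
  simp only [stat_eq_evenStat_one]

/-- **Transfer in the useful direction, spelled out**: a proof of the constant-mark `evenStat` statement (e.g. the
`even-rung-mean-variance` chassis of crux stmt-13079 run at `Ξ ≡ 1`) proves the route decl `CollisionRate`.
[folklore] -/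
theorem collisionRate_of_evenStat_one
    (h : ∃ η₀ : ℝ, 0 < η₀ ∧ ∀ (a₀ θ₀ : T3 → ℝ) (u₀ : T3 → V3), Continuous a₀ → Continuous θ₀ → Continuous u₀ →
      (∀ x, 0 < a₀ x) → (∀ x, 0 < θ₀ x) → ∃ σ₀ : ℝ, 0 < σ₀ ∧ ∀ σ : ℝ, 0 < σ → σ < σ₀ →
      ∀ Φ : (N : ℕ) → HardSphereFlow (Torus.geometry (Fin 3)) (hsDiameter σ N) (N + 1),
      ∀ τ : ℝ, 0 < τ → ∀ χ : ℝ × T3 → ℝ, Continuous χ → ∀ g : ℝ → ℝ, Continuous g →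
      (∀ a, η₀ ≤ a → g a = 0) →
      ∀ η δ : ℝ, 0 < η → 0 < δ → ∃ r₀ : ℝ, 0 < r₀ ∧ ∀ r : ℝ, 0 < r → r < r₀ →
      ∃ N₀ : ℕ, ∀ N : ℕ, N₀ ≤ N →
        localGibbsLaw σ a₀ u₀ θ₀ N (Φ N) {z | η < |evenStat σ N (Φ N) τ χ g (fun _ => 1) r z|}
          ≤ ENNReal.ofReal δ) :
    Summit.AtomisticToContinuum.HydrodynamicLimit.Theses.InformationPercolationEngine.CollisionRate :=
  collisionRate_iff_evenStat_one.2 h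

end Summit.AtomisticToContinuum.HydrodynamicLimit.Theorems.CollisionRate

end
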